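import Summits.ValiantsHypothesis.ValiantsHypothesis.Theorems.BarrierLeverPartitionMinorsChowProductStateTables
import Summits.ValiantsHypothesis.ValiantsHypothesis.Theorems.BarrierLeverPartitionMinorsChowLockedStar

/-!
# Route BarrierLever — Chow witnesses for partition minors (item 20172, CPM): FULL HAMMING-BALL ROWS
# AROUND ANY CENTRE × AFFINELY INDEPENDENT COLUMNS, every height

Helper file (`--supports stmt-ValiantsHypothesis-20172`; cell valiant-natproofs, rung V4, 𝒟-side of
door (c); seat valiant-natproofs-prover gen 12).  Closes NO item; definition-free.

Conventions of items 19717 / 20172 / 20195: `x_a = X (Fin.castAdd h a)`, `y_c = X (Fin.natAdd h c)`,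
`E u w = Σ_{a∈u} e_{x_a} + Σ_{c∈w} e_{y_c}`; a layout `(u, w)` is CHOW-HIT when some product of `h + h`
affine forms `ℓ_k` has `det[coeff_{E (u i) (w j)} ∏ ℓ] ≠ 0`.

The `(h, h + 1)` CORES of the engine `chow_hit_of_core` (locked, unpeelable, `r = h + 1`) are
dominated by STAR rows: the whole Hamming ball `{B} ∪ {B ∆ {a} : a < h}` around a centre `B`
(`…ChowLockedStar`, `…ChowSizeFive`, the censuses of val-np-p4 g12).  For the centre `B = ∅` (rows of
size `≤ 1`) val-np-p7 proved the hit for affinely independent columns (`ChowThinAffine.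
chow_hit_thin1_of_affineIndependent`) and then for all columns (`ChowThinAll.chowHits_firstOrderRows`).
Here the FIRST of these is moved to an ARBITRARY CENTRE, for the full ball:

* `chow_hit_ball_of_affineIndependent` — if `u : Fin (h+1) → Finset (Fin h)` is injective with every
  `u i` at symmetric-difference distance `≤ 1` from `B`, and the homogenised column indicators
  `(1, 1_{w j}) ∈ ℂ^{h+1}` are linearly independent (the `h + 1` points `1_{w j}` are affinely
  independent), then the layout is Chow-hit.

Proof: the DECOUPLED site tables `m a ε η = 1` if `ε = [a ∈ B]`, else `1 + [η]` (paired by the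
identity) give the matrix `M[i, j] = ∏_{a ∈ u i ∆ B} (1 + [a ∈ w j])`, i.e. the all-ones row at the
centre and `1 + [a ∈ w j]` at the row `B ∆ {a}`; subtracting the centre row leaves the bordered
incidence matrix `[𝟙 | ([a ∈ w j])]`, a column permutation of the homogenised indicator matrix; the
tables are Chow tables by `chow_hit_of_siteTables` (`…ChowProductStateTables`).  Why only the full
ball and only affinely independent columns: any decoupled design makes the row `B ∆ {a}` a function of
the single bit `[a ∈ w j]`, so partial balls whose free coordinate is constant on the columns, and
affinely dependent columns, need COUPLED designs (val-np-p7's machinery for `B = ∅`; open for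
`B ≠ ∅` — the remaining part of the star cores).

WHAT THIS IS NOT: affinely DEPENDENT column families (where the `(h, h+1)` cores actually live when
the columns avoid the degrees `1, h`) are not treated; nothing on items 20172 / 20195 / 19717
themselves, on crux stmt-ValiantsHypothesis-14610, or on `VP` versus `VNP`.
-/

set_option linter.dupNamespace false

namespace Summit.ValiantsHypothesis.ValiantsHypothesis.Theorems.BarrierLever.ChowFactor

open Finset MvPolynomial

noncomputable section

variable {h : ℕ}

/-- The ball tables: at the centre's bit the site is blind (`1`), at the flipped bit it reads the
column bit (`1 + [η]`).  Their product over the sites, at a row `v` with `#(v ∆ B) ≤ 1`: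
`∏_a m a [a ∈ v] [a ∈ w] = 1` if `v = B`, and `= 1 + [a₀ ∈ w]` if `v = B ∆ {a₀}`. -/
theorem prod_ballTable_center (B w : Finset (Fin h)) :
    (∏ a : Fin h, (if decide (a ∈ B) = decide (a ∈ B) then (1 : ℂ)
      else 1 + (if decide (a ∈ w) = true then 1 else 0))) = 1 :=
  Finset.prod_eq_one fun a _ => by rw [if_pos rfl]

/-- The ball tables at a flipped row `B ∆ {a₀}`: only the site `a₀` reads the column, giving
`1 + [a₀ ∈ w]`. -/
theorem prod_ballTable_flip (B w : Finset (Fin h)) (a₀ : Fin h) :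
    (∏ a : Fin h, (if decide (a ∈ symmDiff B {a₀}) = decide (a ∈ B) then (1 : ℂ)
      else 1 + (if decide (a ∈ w) = true then 1 else 0))) =
      1 + (if a₀ ∈ w then 1 else 0) := by
  classical
  rw [← Finset.mul_prod_erase Finset.univ _ (Finset.mem_univ a₀)]
  have hflip : ¬ (decide (a₀ ∈ symmDiff B {a₀}) = decide (a₀ ∈ B)) := by
    by_cases hb : a₀ ∈ B <;> simp [Finset.mem_symmDiff, Finset.mem_singleton, hb]
  have hrest : ∀ a ∈ Finset.univ.erase a₀,
      (if decide (a ∈ symmDiff B {a₀}) = decide (a ∈ B) then (1 : ℂ)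
        else 1 + (if decide (a ∈ w) = true then 1 else 0)) = 1 := by
    intro a ha
    have hne : a ≠ a₀ := (Finset.mem_erase.mp ha).1
    have hsame : decide (a ∈ symmDiff B {a₀}) = decide (a ∈ B) := by
      by_cases hb : a ∈ B <;> simp [Finset.mem_symmDiff, Finset.mem_singleton, hb, hne]
    rw [if_pos hsame]
  rw [Finset.prod_congr rfl hrest, Finset.prod_const_one, mul_one, if_neg hflip]
  by_cases hw : a₀ ∈ w <;> simp [hw]

/-- **FULL HAMMING-BALL ROWS AROUND ANY CENTRE × AFFINELY INDEPENDENT COLUMNS ARE CHOW-HIT (every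
height).**  Rows: an injective family of `h + 1` sets at symmetric-difference distance `≤ 1` from a
centre `B` (so: the whole ball `{B} ∪ {B ∆ {a}}`); columns: `h + 1` sets whose homogenised indicators
`(1, 1_{w j})` are linearly independent.  Then some product of `h + h` affine forms has a nonzero
partition minor on `(u, w)` — item 20172's conclusion for these layouts. -/
theorem chow_hit_ball_of_affineIndependent (B : Finset (Fin h)) (u w : Fin (h + 1) → Finset (Fin h))
    (hu : Function.Injective u) (hball : ∀ i, (symmDiff (u i) B).card ≤ 1)
    (haff : LinearIndependent ℂ (fun j : Fin (h + 1) =>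
      (Fin.cons (1 : ℂ) (fun c : Fin h => if c ∈ w j then (1 : ℂ) else 0) : Fin (h + 1) → ℂ))) :
    ∃ ℓ : Fin (h + h) → MvPolynomial (Fin (h + h)) ℂ, (∀ q, (ℓ q).totalDegree ≤ 1) ∧
      (Matrix.of fun i j : Fin (h + 1) => coeff
        (∑ b ∈ u i, Finsupp.single (Fin.castAdd h b) 1 + ∑ d ∈ w j, Finsupp.single (Fin.natAdd h d) 1)
        (∏ q, ℓ q)).det ≠ 0 := by
  classical
  -- the centre row `i₀` and the flipped coordinate `flip i` of every other row
  obtain ⟨i₀, hi₀⟩ := exists_index_eq_of_star u hu le_rfl B hball B (by simp)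
  have hflip : ∀ i, i ≠ i₀ → ∃ a, u i = symmDiff B {a} := fun i hi => by
    rcases eq_or_eq_symmDiff_singleton_of_card_le_one B (u i) (hball i) with h1 | h1
    · exact absurd (hu (h1.trans hi₀.symm)) hi
    · exact h1
  choose flip hflip_spec using hflip
  have flip_inj : ∀ i i' (hi : i ≠ i₀) (hi' : i' ≠ i₀), flip i hi = flip i' hi' → i = i' :=
    fun i i' hi hi' e => hu (by rw [hflip_spec i hi, hflip_spec i' hi', e])
  -- the column relabelling `σ : rows → Fin (h+1)`: centre ↦ 0, row `B ∆ {a}` ↦ `a.succ`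
  let σf : Fin (h + 1) → Fin (h + 1) := fun i => if hi : i = i₀ then 0 else (flip i hi).succ
  have σ_inj : Function.Injective σf := by
    intro i i' e
    by_cases hi : i = i₀ <;> by_cases hi' : i' = i₀
    · rw [hi, hi']
    · simp only [σf, dif_pos hi, dif_neg hi'] at e; exact absurd e.symm (Fin.succ_ne_zero _)
    · simp only [σf, dif_neg hi, dif_pos hi'] at e; exact absurd e (Fin.succ_ne_zero _)
    · simp only [σf, dif_neg hi, dif_neg hi'] at e; exact flip_inj i i' hi hi' (Fin.succ_injective _ e)
  let σ : Equiv.Perm (Fin (h + 1)) := Equiv.ofBijective σf (Finite.injective_iff_bijective.mp σ_inj)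
  -- homogenised indicator matrix `Z` (rows = columns `w j`)
  set Z : Matrix (Fin (h + 1)) (Fin (h + 1)) ℂ := Matrix.of fun j k =>
    (Fin.cons (1 : ℂ) (fun c : Fin h => if c ∈ w j then (1 : ℂ) else 0) : Fin (h + 1) → ℂ) k with hZ
  have hZdet : Z.det ≠ 0 := by
    have hrow : LinearIndependent ℂ Z.row := haff
    have hunit := Matrix.linearIndependent_rows_iff_isUnit.mp hrow
    rw [Matrix.isUnit_iff_isUnit_det] at hunit
    exact hunit.ne_zero
  -- apply the transfer with the ball tables
  refine chow_hit_of_siteTables u w (Equiv.refl _)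
    (fun a ε η => if ε = decide (a ∈ B) then (1 : ℂ) else 1 + (if η = true then 1 else 0)) ?_
  -- the table matrix: all-ones at the centre row, `1 + [flip i ∈ w j]` elsewhere
  have hT : (Matrix.of fun i j : Fin (h + 1) => ∏ a : Fin h,
        (if decide (a ∈ u i) = decide (a ∈ B) then (1 : ℂ)
          else 1 + (if decide ((Equiv.refl (Fin h)) a ∈ w j) = true then 1 else 0))) =
      Matrix.of fun i j : Fin (h + 1) =>
        if hi : i = i₀ then (1 : ℂ) else 1 + (if flip i hi ∈ w j then 1 else 0) := by
    ext i j
    simp only [Matrix.of_apply, Equiv.refl_apply]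
    by_cases hi : i = i₀
    · rw [dif_pos hi, hi, hi₀]; exact prod_ballTable_center B (w j)
    · rw [dif_neg hi, hflip_spec i hi]; exact prod_ballTable_flip B (w j) (flip i hi)
  rw [hT]
  -- subtract the centre row: the result is `Z` with columns relabelled by `σ`, transposed
  have hsub : (Matrix.of fun i j : Fin (h + 1) =>
        if hi : i = i₀ then (1 : ℂ) else 1 + (if flip i hi ∈ w j then 1 else 0)).det =
      ((Z.submatrix id σ).transpose).det := by
    refine Matrix.det_eq_of_forall_row_eq_smul_add_const (fun i => if i = i₀ then (0 : ℂ) else 1) i₀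
      (if_pos rfl) fun i j => ?_
    rw [Matrix.of_apply, Matrix.transpose_apply, Matrix.submatrix_apply, Matrix.transpose_apply,
      Matrix.submatrix_apply, hZ, Matrix.of_apply, Matrix.of_apply]
    show _ = (Fin.cons (1 : ℂ) (fun c : Fin h => if c ∈ w j then (1 : ℂ) else 0) : Fin (h + 1) → ℂ)
        (σf i) + (if i = i₀ then (0 : ℂ) else 1) *
          (Fin.cons (1 : ℂ) (fun c : Fin h => if c ∈ w j then (1 : ℂ) else 0) : Fin (h + 1) → ℂ)
            (σf i₀)
    by_cases hi : i = i₀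
    · rw [dif_pos hi, if_pos hi]
      simp only [σf, dif_pos hi, dif_pos rfl, Fin.cons_zero]; ring
    · simp only [σf, dif_neg hi, dif_pos rfl, if_neg hi, Fin.cons_succ, Fin.cons_zero]; ring
  rw [hsub, Matrix.det_transpose, Matrix.det_permute', mul_ne_zero_iff]
  exact ⟨Int.cast_ne_zero.mpr (Units.ne_zero _), hZdet⟩

end

end Summit.ValiantsHypothesis.ValiantsHypothesis.Theorems.BarrierLever.ChowFactor
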